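import Summits.KontsevichZagierPeriods.KontsevichZagierPeriods.Theorems.FurushoPentagonPentagonInKZCornerPeel
import Literature.NumberTheory.Transcendental.DrinfeldAssociatorRegularisation
import Literature.NumberTheory.Transcendental.Associators

/-!
# `PentagonInKZ`, line `edge-normal-newton-leibniz`: corner engine — the edge centrality at
height `0` for the regularised horizontal series

Stub `cornerEngine_centralH` of the crux `FurushoPentagon.PentagonInKZ`
(stmt-KontsevichZagierPeriods-11348).

With the dictionary of the corner engine (letter densities `fd`, dilated cubical word integrands
`qH`, end-regularised integrands `Ht U x ξ η = Σ_u ⟨regEnd₀ U, u⟩ · qH u x ξ η`, residue monomials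
`wZ U = Z_{U₀} ⋯ Z_{U_{k-1}} ∈ DK_N(ℚ)`) and a `ℚ`-linear functional `μ` on `DK_N(ℚ)` such that,
for all context factors `P, Q`,

* `μ(P [Z₀, Z₁] Q) = 0` and
* `Σ_k fd k t 0 · μ(P [Z₁, Z_k] Q) = 0` for `t ∈ (0, α)` (the edge centrality of the connection at
  height `0`, in functional form),

the log-free horizontal transport at height `0` commutes with `Z₁` at the series level:
`Σ_U μ(P [Z₁, wZ U] Q) · Ht U x ξ 0 = 0` for `x` in the open cube and `0 < ξ ≤ α`.

Proof: induction on the length `k` of `U`, peeling the outermost letter with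
`CornerEnginePeel.peel` (the first-letter stripping rule of the end regularisation, resummed):
the weight `W U = μ(P [Z₁, wZ U] Q)` obeys the Leibniz rule
`W (a U') = μ(P [Z₁, Z_a] wZ U' Q) + μ((P Z_a) [Z₁, wZ U'] Q)` and
`W (U' 0) = μ(P [Z₁, wZ U'] (Z₀ Q)) + μ((P wZ U') [Z₁, Z₀] Q)`; the second terms are an instance of
the induction hypothesis at the dilated abscissa `ξ x₀ ∈ (0, α)` resp. of the first hypothesis,
and the letter sum `Σ_a h_a(x₀) μ(P [Z₁, Z_a] Q'')` of the first term is
`x₀⁻¹ μ(P [Z₁, Z₀] Q'') + ξ Σ_{a ≠ 0} fd a (ξ x₀) 0 · μ(P [Z₁, Z_a] Q'') = 0` by the two hypotheses.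

References: V. G. Drinfeld, Leningrad Math. J. 2 (1991), §2; K. Ihara, M. Kaneko, D. Zagier,
Compos. Math. 142 (2006), Cor. 5.
-/

noncomputable section

open scoped BigOperators
open Literature.NumberTheory.Transcendental

namespace Summit.KontsevichZagierPeriods.FurushoPentagon.PentagonInKZ

namespace CornerEngineCentralH

variable {A : Type*} [Ring A]

/-- `[Z, ·]` is a derivation: `P [Z, a W] Q = P [Z, a] (W Q) + (P a) [Z, W] Q`. [folklore] -/
theorem conj_comm_mul_left (P Q Z a W : A) :
    P * (Z * (a * W) - a * W * Z) * Q =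
      P * (Z * a - a * Z) * (W * Q) + P * a * (Z * W - W * Z) * Q := by
  noncomm_ring

/-- `[Z, ·]` is a derivation: `P [Z, W b] Q = P [Z, W] (b Q) + (P W) [Z, b] Q`. [folklore] -/
theorem conj_comm_mul_right (P Q Z W b : A) :
    P * (Z * (W * b) - W * b * Z) * Q =
      P * (Z * W - W * Z) * (b * Q) + P * W * (Z * b - b * Z) * Q := by
  noncomm_ring

/-- `P [b, a] Q = -(P [a, b] Q)`. [folklore] -/
theorem conj_comm_swap (P Q a b : A) :
    P * (b * a - a * b) * Q = -(P * (a * b - b * a) * Q) := by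
  noncomm_ring

/-- `Σ_a h a · Σ_{U'} A a U' · T U' = Σ_{U'} (Σ_a h a · A a U') · T U'`. [folklore] -/
theorem sum_mul_sum_mul_comm {ι κ : Type*} [Fintype ι] [Fintype κ] (h : ι → ℝ)
    (A' : ι → κ → ℝ) (T : κ → ℝ) :
    ∑ a, h a * ∑ U', A' a U' * T U' = ∑ U', (∑ a, h a * A' a U') * T U' := by
  simp_rw [Finset.mul_sum, Finset.sum_mul, mul_assoc]
  exact Finset.sum_comm

end CornerEngineCentralH

open CornerEnginePeel CornerEngineCentralH in
/-- **Stub `cornerEngine_centralH`** — THE EDGE CENTRALITY AT HEIGHT `0` AT THE SERIES LEVEL for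
the horizontal side of the corner engine.  With the dictionary of the engine (letter densities
`fd`, dilated cubical word integrands `qH`, end-regularised integrands
`Ht U x ξ η = Σ_u ⟨regEnd₀ U, u⟩ qH u x ξ η`, residue monomials `wZ U = Z_{U₀} ⋯ Z_{U_{k-1}}`) and
a `ℚ`-linear functional `μ` on `DK_N(ℚ)` with `μ(P [Z₀, Z₁] Q) = 0` and
`Σ_k fd k t 0 · μ(P [Z₁, Z_k] Q) = 0` (`0 < t < α`) for all context factors `P, Q`:
`Σ_U μ(P [Z₁, wZ U] Q) · Ht U x ξ 0 = 0` for `x` in the open cube and `0 < ξ ≤ α` — i.e.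
`[Z₁, H₀(ξ)] = 0` for the log-free horizontal transport at height `0`.  Induction on the word
length, peeling the outermost letter (`CornerEnginePeel.peel`) and using the Leibniz rule for
`[Z₁, ·]`. [cite: Drinfeld1991, §2] -/
theorem cornerEngine_centralH :
    ∀ (m : ℕ) (cf : Fin (m + 2) → Fin 4 → ℚ) (α : ℚ) (N : ℕ) (nZ : Fin (m + 2) → Fin 4 → Fin 4 → ℤ) (fd : Fin (m + 2) → ℝ → ℝ → ℝ) (hfd : ∀ k t y, fd k t y = ((cf k 1 : ℝ) + (cf k 3 : ℝ) * y) / ((cf k 0 : ℝ) + (cf k 1 : ℝ) * t + (cf k 2 : ℝ) * y + (cf k 3 : ℝ) * t * y)) (qH : ∀ {n : ℕ}, (Fin n → Fin (m + 2)) → (Fin n → ℝ) → ℝ → ℝ → ℝ) (hqH : ∀ {n : ℕ} (u : Fin n → Fin (m + 2)) (x : Fin n → ℝ) (ξ η : ℝ), qH u x ξ η = ∏ i, if u i = 0 then 1 / x i else (ξ * ∏ j ∈ Finset.univ.filter (fun j => j < i), x j) * fd (u i) (ξ * ∏ j ∈ Finset.univ.filter (fun j => j ≤ i), x j) η) (Ht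 : ∀ {n : ℕ}, (Fin n → Fin (m + 2)) → (Fin n → ℝ) → ℝ → ℝ → ℝ) (hHt : ∀ {n : ℕ} (U : Fin n → Fin (m + 2)) (x : Fin n → ℝ) (ξ η : ℝ), Ht U x ξ η = ∑ u : Fin n → Fin (m + 2), (Shuffle.regEnd (0 : Fin (m + 2)) (List.ofFn U) (List.ofFn u) : ℝ) * qH u x ξ η) (wZ : ∀ {n : ℕ}, (Fin n → Fin (m + 2)) → DrinfeldKohnoTrunc ℚ (Fin 4) N) (hwZ : ∀ {n : ℕ} (U : Fin n → Fin (m + 2)), wZ U = ((List.ofFn U).map fun k => ∑ i : Fin 4, ∑ j : Fin 4, (nZ k i j : ℚ) • DrinfeldKohnoTrunc.t ℚ N i j).prod) (Zq : Fin (m + 2) → DrinfeldKohnoTrunc ℚ (Fin 4) N) (hZq : ∀ k, Zq k = (∑ i : Fin 4, ∑ j : Fin 4, (nZ k i j : ℚ) • DrinfeldKohnoTrunc.t ℚ N i j)) (μ : DrinfeldKohnoTrunc ℚ (Fin 4) N →ₗ[ℚ] ℚ), (∀ P Q : DrinfeldKohnoTrunc ℚ (Fin 4) N, μ (P * (Zq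 0 * Zq 1 - Zq 1 * Zq 0) * Q) = 0) → (∀ t : ℝ, 0 < t → t < (α : ℝ) → ∀ P Q : DrinfeldKohnoTrunc ℚ (Fin 4) N, ∑ k : Fin (m + 2), fd k t 0 * (μ (P * (Zq 1 * Zq k - Zq k * Zq 1) * Q) : ℝ) = 0) → ∀ {k : ℕ} (P Q : DrinfeldKohnoTrunc ℚ (Fin 4) N) (x : Fin k → ℝ) (ξ : ℝ), (∀ i, 0 < x i ∧ x i < 1) → 0 < ξ → ξ ≤ (α : ℝ) → ∑ U : Fin k → Fin (m + 2), (μ (P * (Zq 1 * wZ U - wZ U * Zq 1) * Q) : ℝ) * Ht U x ξ 0 = 0 := by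
  intro m cf α N nZ fd _ qH hqH Ht hHt wZ hwZ Zq hZq μ h01 hsum k
  -- the residue letters
  have hZ : (fun k => ∑ i : Fin 4, ∑ j : Fin 4, (nZ k i j : ℚ) • DrinfeldKohnoTrunc.t ℚ N i j) = Zq :=
    funext fun k => (hZq k).symm
  have hwZ_cons : ∀ {k : ℕ} (a : Fin (m + 2)) (U' : Fin k → Fin (m + 2)),
      wZ (Fin.cons a U') = Zq a * wZ U' := fun a U' => by
    rw [hwZ, hwZ, hZ, prod_map_ofFn_cons]
  have hwZ_snoc : ∀ {k : ℕ} (U' : Fin k → Fin (m + 2)) (b : Fin (m + 2)),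
      wZ (Fin.snoc U' b) = wZ U' * Zq b := fun U' b => by
    rw [hwZ, hwZ, hZ, prod_map_ofFn_snoc]
  -- `μ(P [Z₁, Z₀] Q) = 0`
  have h10 : ∀ P Q : DrinfeldKohnoTrunc ℚ (Fin 4) N, μ (P * (Zq 1 * Zq 0 - Zq 0 * Zq 1) * Q) = 0 :=
    fun P Q => by rw [conj_comm_swap, map_neg, h01, neg_zero]
  induction k with
  | zero =>
    intro P Q x ξ _ _ _
    refine Finset.sum_eq_zero fun U _ => ?_
    rw [hwZ, List.ofFn_zero, List.map_nil, List.prod_nil, mul_one, one_mul, sub_self, mul_zero,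
      zero_mul, map_zero, Rat.cast_zero, zero_mul]
  | succ k ih =>
    intro P Q x ξ hx hξ hξα
    -- split off the outermost variable `x₀`
    set x₀ : ℝ := x 0
    set x' : Fin k → ℝ := Fin.tail x
    have hxe : x = Fin.cons x₀ x' := (Fin.cons_self_tail x).symm
    have hx0 : 0 < x₀ ∧ x₀ < 1 := hx 0
    have hx'1 : ∀ i, 0 < x' i ∧ x' i < 1 := fun i => hx i.succ
    have ht0 : 0 < ξ * x₀ := mul_pos hξ hx0.1
    have htα : ξ * x₀ < α := (mul_lt_of_lt_one_right hξ hx0.2).trans_le hξα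
    -- the letter sum at the dilated abscissa `ξ x₀ ∈ (0, α)` vanishes
    have hletter : ∀ Q'' : DrinfeldKohnoTrunc ℚ (Fin 4) N,
        ∑ a : Fin (m + 2), (if a = 0 then 1 / x₀ else ξ * fd a (ξ * x₀) 0) *
          (μ (P * (Zq 1 * Zq a - Zq a * Zq 1) * Q'') : ℝ) = 0 := by
      intro Q''
      have hs := hsum (ξ * x₀) ht0 htα P Q''
      rw [Fin.sum_univ_succ, h10] at hs
      rw [Fin.sum_univ_succ, h10]
      simp only [Rat.cast_zero, mul_zero, zero_add, Fin.succ_ne_zero, if_false] at hs ⊢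
      calc ∑ b : Fin (m + 1), ξ * fd b.succ (ξ * x₀) 0 *
            (μ (P * (Zq 1 * Zq b.succ - Zq b.succ * Zq 1) * Q'') : ℝ)
          = ξ * ∑ b : Fin (m + 1), fd b.succ (ξ * x₀) 0 *
            (μ (P * (Zq 1 * Zq b.succ - Zq b.succ * Zq 1) * Q'') : ℝ) := by
            rw [Finset.mul_sum]
            exact Finset.sum_congr rfl fun b _ => mul_assoc _ _ _
        _ = 0 := by rw [hs, mul_zero]
    -- two instances of the induction hypothesis at `(x', ξ x₀)`
    have ih1 : ∀ a : Fin (m + 2), ∑ U' : Fin k → Fin (m + 2),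
        (μ (P * Zq a * (Zq 1 * wZ U' - wZ U' * Zq 1) * Q) : ℝ) * Ht U' x' (ξ * x₀) 0 = 0 :=
      fun a => ih (P * Zq a) Q x' (ξ * x₀) hx'1 ht0 htα.le
    have ih2 : ∑ U' : Fin k → Fin (m + 2),
        (μ (P * (Zq 1 * wZ U' - wZ U' * Zq 1) * (Zq 0 * Q)) : ℝ) * Ht U' x' (ξ * x₀) 0 = 0 :=
      ih P (Zq 0 * Q) x' (ξ * x₀) hx'1 ht0 htα.le
    -- peel the outermost letter
    have key := peel (0 : Fin (m + 2)) (fun u => qH u (Fin.cons x₀ x') ξ 0)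
      (fun u' => qH u' x' (ξ * x₀) 0) (fun a => if a = 0 then 1 / x₀ else ξ * fd a (ξ * x₀) 0)
      (fun a u' => by rw [hqH, hqH]; exact prod_peel 0 (fun a t => fd a t 0) a u' x₀ ξ x')
      (fun U => (μ (P * (Zq 1 * wZ U - wZ U * Zq 1) * Q) : ℝ))
      (fun a U' => (μ (P * (Zq 1 * Zq a - Zq a * Zq 1) * (wZ U' * Q)) : ℝ) +
        (μ (P * Zq a * (Zq 1 * wZ U' - wZ U' * Zq 1) * Q) : ℝ))
      (fun U' => (μ (P * (Zq 1 * wZ U' - wZ U' * Zq 1) * (Zq 0 * Q)) : ℝ))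
      (fun a U' => by rw [hwZ_cons, conj_comm_mul_left, map_add, Rat.cast_add])
      (fun U' => by rw [hwZ_snoc, conj_comm_mul_right, map_add, h10, add_zero])
    simp only [if_true, ← hHt] at key
    rw [hxe, key]
    simp only [add_mul, Finset.sum_add_distrib, ih1, ih2, add_zero, mul_zero, sub_zero,
      sum_mul_sum_mul_comm, hletter, zero_mul, Finset.sum_const_zero]

end Summit.KontsevichZagierPeriods.FurushoPentagon.PentagonInKZ
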